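import Literature.MathematicalPhysics.QuantumFieldTheory.Balaban1983to89.Node00.CriticalOnFibreTopGuarded
import Literature.MathematicalPhysics.QuantumFieldTheory.Balaban1983to89.Node00.CriticalOnFibreTopCore
import Literature.MathematicalPhysics.QuantumFieldTheory.Balaban1983to89.Node00.TkFirstStepRegionVanishing
import Summits.QuantumFields.YangMills.Theorems.BalabanUVNodesK0VariationalThm1OuterRange
import Summits.QuantumFields.YangMills.Theorems.BalabanUVNodesN07LocalLettersCoreFloor

/-!
# K0⁷ — THE CORE ⇒ TOP LINK OF [15] SECT. F's ONE-STEP IMPROVEMENT, POINTWISE, WITH THE FLOOR `c ≤ ν.M₁`, AND UNDER ANY PREFIX GUARD: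
# `HalvingStepTopCoreR c ⇒ HalvingStepTopR c ⇔ Prop8RegSepTopStepR c`, `HalvingStepTopCoreG Adm ⇒ HalvingStepTopG Adm ⇒ Prop8RegSepTopStepG Adm` (dag-n07-e module 47's `hlink`
# DISCHARGED), and the floor-carrying chain end to end from the S6 head's per-datum R-tokens

Cell `pub-ymgap`, seat `pub-ymgap-k0-s1-w3` g6 (K0⁷ `stmt-QuantumFields-20541`; CLAIM-1 of 2026-08-28 — the R-edition of p586684 `K0HalvingStepOfCore.halvingStepTop_of_core`, after
dag-n07-e's LOCATED-STUB1-FLOOR and modules 46∕47).  `--kind proof --supports stmt-QuantumFields-20541 --as helper`; THEOREMS ONLY (0 def).  CONSUMED BY NAME: p586684 §§0–2 lemmas (since the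
v-edition: PRIVATE re-homes §0′), dag-n07-e modules 46 (`HalvingStepTopR`, `HalvingStepTopCoreR`, `Prop8RegSepTopStepR`, …) ∕ 47 `Node00.CriticalOnFibreTopGuarded` (`StepGuard`, `floorGuard`,
`HalvingStepTopG`, `HalvingStepTopCoreG`, `Prop8RegSepTopStepG`, `prop8RegSepTopStepG_of_coreG_of_link`, …), dag-n07-w4 p621398 (the head's four R-tokens and their compositions).
[15] = [Balaban1985Variational]; [6] = [Balaban1985RegularSpaces]; [III] = [Balaban1988Convergent].  WHY: repair (R-a) of dag-n07-e's LOCATED-STUB1-FLOOR — the link WITH the floor `c ≤ ν.M₁`.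
WHAT THIS FILE PROVES (kernel, sorry-free, standard axioms).  §1 ★★ `halvingStep_top_of_core_at` — the link POINTWISE at one binder instance (printed level-0 plaquettes `< δ₀ ≤ B₃δ₀`;
level-1 corner plaquettes `< δ₀ ≤ 2δ₁ ≤ B₃δ₁L⁻²` — the floor `2L² ≤ B₃`; no printed plaquette meets `Ω_n`, `n ≥ 2`; far bonds `≤ 8δ₀ < B₃δ₀`).  §2 ★★ `halvingStepTopR_of_coreR`,
★ `halvingStepTopR_iff_coreR`, ★★ `prop8RegSepTopStepR_of_coreR_of_sup` ∕ `prop8RegSepTopStepR_of_coreR`.  §3 under ANY `Adm : StepGuard F`: ★★ `halvingStepTopG_of_coreG`, ★ `halvingStepTopG_iff_coreG`,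
★★ `prop8RegSepTopStepG_of_coreG_of_sup` ∕ `prop8RegSepTopStepG_of_coreG` (module 47's `hlink` DISCHARGED).  §4 end to end from the head's R-tokens: `prop8RegSepTopStepR_of_localLetters165CoreR` ∕
`…_of_localLettersSplitCoreR` ∕ `…_of_datumGauge165CoreR` ∕ `…_of_datumGaugeSplitCoreR`.  §5 the (R-b) candidate shape: `prop8StepCoPR_of_coreR`, `prop8StepCoPR_of_datumGaugeSplitCoreR`.
HONEST SCOPE ∕ A6.  CONDITIONAL compositions: every antecedent token is [15] Sect. F's open analytic content at NODE 00's objects — displayed, NEVER asserted; binder blocks inhabited (p586684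
§4 ∕ dag-n07-e module 32), so not vacuous; §1 proves OUTRIGHT only finite-torus stencil geometry + real monotonicity.  Floor-free tokens NOT claimed false.  Count-neutral; stub 1 ∕ K0⁷ NOT
closed; N07 NOT discharged; one finite 𝕋⁴ programme at fixed ε; R4 closes the conditional finite-𝕋⁴ rung `BalabanLadder.UV` only — the YM mass gap (Clay) is NOT proved; nothing continuum ∕
ℝ⁴ ∕ OS.  No `def` ∕ `instance` ∕ `notation` ∕ `sorry`.  (v1.0 prose: ledger copy; header compressed for the 400-line limit.)
v-edition (director-ym №365 (2)–(4), row group 13′ — imports re-pointed + PRIVATE re-homes §0′ + every existing declaration BYTE-IDENTICAL; lint-clean in place; pen dag-n07-e g34):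
`import …K0HalvingStepOfCore` (residue after the Stage-2 seam — socket-typed §3, CLASS-T cone) ↦ its three green parents; `…OfCoreGuardedChain` and the 130 chart-road modules above then import no residue.
-/

noncomputable section

namespace Summit.QuantumFields.YangMills.Theorems.K0HalvingStepOfCoreFloor

open scoped Matrix.Norms.L2Operator
open Literature.MathematicalPhysics.QuantumFieldTheory.Balaban1983to89
open Literature.MathematicalPhysics.QuantumFieldTheory.Balaban1983to89.Node00
open Literature.MathematicalPhysics.QuantumFieldTheory.Balaban1983to89.T4Continuum
open Literature.MathematicalPhysics.QuantumFieldTheory.Balaban1983to89.FlowStep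
open B15DeterminingSets
open Summit.QuantumFields.YangMills.Theorems.K0VariationalThm1OuterRange (mem_printedPlaqs_zero_iff_bonds mem_bondsOf_genSet_zero_iff
  plaqHol_eq_of_agreeOn_of_mem_printedPlaqs_zero)
open Summit.QuantumFields.YangMills.BalabanUVNodes.N07LocalLettersCoreFloor (LocalLetters165TopStepCoreR LocalLettersSplitTopStepCoreR
  DatumGauge165TopStepCoreR DatumGaugeSplitTopStepCoreR halvingStepTopCoreR_of_localLetters165CoreR halvingStepTopCoreR_of_localLettersSplitCoreR
  halvingStepTopCoreR_of_datumGauge165CoreR halvingStepTopCoreR_of_datumGaugeSplitCoreR)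

/-! ## §0′  PRIVATE RE-HOMES of p586684 §§0–2 lemmas this file consumes (director-ym №365 (2)–(4), row group 13′; statements + proofs verbatim, `private`) -/
/-- PRIVATE RE-HOME (director-ym №365 (2)–(4), row group 13′; R556): verbatim copy of `Summit.QuantumFields.YangMills.Theorems.K0HalvingStepOfCore.shift_unshift_site (private)` — its module `…K0HalvingStepOfCore (p586684)` is residue after the Stage-2 seam and can no longer be imported on a green road; statement and proof byte-identical to the original, visibility `private` (no new public name, nothing restated for citers). -/
private theorem shift_unshift_site {P : Params} (y : Site P 0) (ν : Fin P.d) : (y.unshift ν).shift ν = y := by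
  funext κ
  by_cases h : κ = ν
  · subst h; simp [Site.shift, Site.unshift]
  · simp [Site.shift, Site.unshift, Function.update_of_ne h]
/-- PRIVATE RE-HOME (director-ym №365 (2)–(4), row group 13′; R556): verbatim copy of `Summit.QuantumFields.YangMills.Theorems.K0HalvingStepOfCore.unshift_shift_comm_site (private)` — its module `…K0HalvingStepOfCore (p586684)` is residue after the Stage-2 seam and can no longer be imported on a green road; statement and proof byte-identical to the original, visibility `private` (no new public name, nothing restated for citers). -/
private theorem unshift_shift_comm_site {P : Params} (x : Site P 0) (μ ν : Fin P.d) : (x.unshift ν).shift μ = (x.shift μ).unshift ν :=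
  (Site.unshift_shift_comm x μ ν).symm
/-- PRIVATE RE-HOME (director-ym №365 (2)–(4), row group 13′; R556): verbatim copy of `Summit.QuantumFields.YangMills.Theorems.K0HalvingStepOfCore.mem_printedPlaqs_zero_of_corners` — its module `…K0HalvingStepOfCore (p586684)` is residue after the Stage-2 seam and can no longer be imported on a green road; statement and proof byte-identical to the original, visibility `private` (no new public name, nothing restated for citers). -/
private theorem mem_printedPlaqs_zero_of_corners {F : T4Family} {K : ℕ} {Ω : ℕ → Set (Site (F.P K) 0)} {k : ℕ} (hk : 0 < k) {q : Plaq (F.P K) 0}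
    (h1 : q.src ∉ Ω 1) (h2 : q.src.shift q.μ ∉ Ω 1) (h3 : q.src.shift q.ν ∉ Ω 1) : q ∈ Sect2.printedPlaqs Ω k 0 := by
  rw [mem_printedPlaqs_zero_iff_bonds Ω hk, mem_bondsOf_genSet_zero_iff Ω hk, mem_bondsOf_genSet_zero_iff Ω hk,
    mem_bondsOf_genSet_zero_iff Ω hk, mem_bondsOf_genSet_zero_iff Ω hk]
  simp only [pts_zero]
  exact ⟨fun h => h1 h.1, fun h => h2 h.1, fun h => h3 h.1, fun h => h1 h.1⟩
/-- PRIVATE RE-HOME (director-ym №365 (2)–(4), row group 13′; R556): verbatim copy of `Summit.QuantumFields.YangMills.Theorems.K0HalvingStepOfCore.not_mem_printedPlaqs_zero_of_mem_plaqsOf` — its module `…K0HalvingStepOfCore (p586684)` is residue after the Stage-2 seam and can no longer be imported on a green road; statement and proof byte-identical to the original, visibility `private` (no new public name, nothing restated for citers). -/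
private theorem not_mem_printedPlaqs_zero_of_mem_plaqsOf {F : T4Family} {K : ℕ} {ν : Stage7Numerics} {M : ℕ} {g : ℕ → ℝ} {k : ℕ} {s : SeqOfRecord F ν M g K k}
    (hsep : Sect2.SeqSeparated ν.M₁ s) (hM₁ : 0 < ν.M₁) {n : ℕ} (h2n : 2 ≤ n) (hnk : n ≤ k) {p : Plaq (F.P K) 0}
    (hp : p ∈ B8Eq17ClassAkV1.plaqsOf (s.Ω n)) : p ∉ Sect2.printedPlaqs s.Ω k 0 := by
  have hk : 0 < k := by omega
  have h1k : 1 < k := by omega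
  have hΩ2 : s.Ω n ⊆ s.Ω 2 := s.chain.Ω_antitone (by norm_num) h2n hnk
  have hΩ1 : s.Ω 2 ⊆ s.Ω 1 := s.chain.Ω_antitone le_rfl one_le_two (by omega)
  -- neighbours of a point of `Ω₂` lie in `Ω₁`
  have hsh : ∀ {x : Site (F.P K) 0}, x ∈ s.Ω 2 → ∀ μ, x.shift μ ∈ s.Ω 1 := fun hx μ => hsep.shift_mem hM₁ le_rfl h1k hx μ
  have hush : ∀ {x : Site (F.P K) 0}, x ∈ s.Ω 2 → ∀ μ, x.unshift μ ∈ s.Ω 1 := fun hx μ => hsep.unshift_mem hM₁ le_rfl h1k hx μ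
  intro hpr
  obtain ⟨hb1, hb2, _, hb4⟩ := (mem_printedPlaqs_zero_iff_bonds s.Ω hk p).1 hpr
  rw [mem_bondsOf_genSet_zero_iff s.Ω hk] at hb1 hb2 hb4
  simp only [pts_zero] at hb1 hb2 hb4
  rcases (B8Eq17ClassAkV1.mem_plaqsOf _ _).1 hp with h | h | h | h
  · exact hb1 ⟨hΩ1 (hΩ2 h), hsh (hΩ2 h) p.μ⟩
  · refine hb1 ⟨?_, hΩ1 (hΩ2 h)⟩
    have := hush (hΩ2 h) p.μ
    rwa [unshift_shift_site] at this
  · refine hb4 ⟨?_, hΩ1 (hΩ2 h)⟩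
    have := hush (hΩ2 h) p.ν
    rwa [unshift_shift_site] at this
  · refine hb2 ⟨?_, hΩ1 (hΩ2 h)⟩
    have := hush (hΩ2 h) p.ν
    rwa [unshift_shift_site] at this
/-- PRIVATE RE-HOME (director-ym №365 (2)–(4), row group 13′; R556): verbatim copy of `Summit.QuantumFields.YangMills.Theorems.K0HalvingStepOfCore.dist1_plaqHol_lt_of_mem_printedPlaqs` — its module `…K0HalvingStepOfCore (p586684)` is residue after the Stage-2 seam and can no longer be imported on a green road; statement and proof byte-identical to the original, visibility `private` (no new public name, nothing restated for citers). -/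
private theorem dist1_plaqHol_lt_of_mem_printedPlaqs {F : T4Family} {N : ℕ} [NeZero N] {K k : ℕ} (hk : 0 < k) {Ω : ℕ → Set (Site (F.P K) 0)} {Ω₀ : Set (Site (F.P K) 0)} {δ : ℕ → ℝ}
    {W : MSField (F.P K) (SU N)} (h7 : Sect2.DataSmall7PTop (avOfRecord F N K) Ω Ω₀ k δ W) {U : GaugeField (F.P K) 0 (SU N)}
    (hfib : AgreeOn (genSet Ω k) (avgFamily (avOfRecord F N K) U) W) {p : Plaq (F.P K) 0} (hpr : p ∈ Sect2.printedPlaqs Ω k 0)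
    (hpΩ₀ : p ∈ B8Eq17ClassAkV1.plaqsOf Ω₀) : dist1 (GaugeField.plaqHol U p) < δ 0 := by
  rw [plaqHol_eq_of_agreeOn_of_mem_printedPlaqs_zero (avOfRecord F N K) hk hfib hpr]
  exact h7.1 p ⟨hpr, hpΩ₀⟩
/-- PRIVATE RE-HOME (director-ym №365 (2)–(4), row group 13′; R556): verbatim copy of `Summit.QuantumFields.YangMills.Theorems.K0HalvingStepOfCore.norm_coDivSum_le_of_mem_bondsDeep_compl` — its module `…K0HalvingStepOfCore (p586684)` is residue after the Stage-2 seam and can no longer be imported on a green road; statement and proof byte-identical to the original, visibility `private` (no new public name, nothing restated for citers). -/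
private theorem norm_coDivSum_le_of_mem_bondsDeep_compl {F : T4Family} {N : ℕ} [NeZero N] {K k : ℕ} (hk : 0 < k) {Ω : ℕ → Set (Site (F.P K) 0)} {Ω₀ : Set (Site (F.P K) 0)} {δ : ℕ → ℝ}
    (hδ0 : 0 ≤ δ 0) {W : MSField (F.P K) (SU N)} (h7 : Sect2.DataSmall7PTop (avOfRecord F N K) Ω Ω₀ k δ W) {U : GaugeField (F.P K) 0 (SU N)}
    (hfib : AgreeOn (genSet Ω k) (avgFamily (avOfRecord F N K) U) W) {b : PBond (F.P K) 0} (hb : b ∈ bondsOf Ω₀)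
    (hbd : b ∈ Sect2.bondsDeep (Ω 1)ᶜ) : ‖Sect2.coDivSum U b.src b.dir‖ ≤ (F.P K).d * (2 * δ 0) := by
  obtain ⟨hx, hxμ, hnb⟩ := hbd
  have hxμ' : b.src.shift b.dir ∉ Ω 1 := hxμ
  have hx' : b.src ∉ Ω 1 := hx
  -- every stencil plaquette is printed and meets `Ω₀`, so it is pinned data `< δ₀`
  have key : ∀ q : Plaq (F.P K) 0, q.src ∉ Ω 1 → q.src.shift q.μ ∉ Ω 1 → q.src.shift q.ν ∉ Ω 1 → q ∈ B8Eq17ClassAkV1.plaqsOf Ω₀ →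
      dist1 (GaugeField.plaqHol U q) ≤ δ 0 := fun q h1 h2 h3 hq =>
    (dist1_plaqHol_lt_of_mem_printedPlaqs hk h7 hfib (mem_printedPlaqs_zero_of_corners hk h1 h2 h3) hq).le
  have hbΩ₀ : b.src ∈ Ω₀ ∨ b.src.shift b.dir ∈ Ω₀ := hb
  refine Sect2.norm_coDivSum_le_of_stencil U hδ0 b.src b.dir (fun ν h => ⟨?_, ?_⟩) (fun ν h => ⟨?_, ?_⟩)
  · -- `p_{νμ}(x − e_ν)`: corners `x − e_ν`, `x`, `(x + e_μ) − e_ν`, `x + e_μ`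
    refine key ⟨b.src.unshift ν, ν, b.dir, h⟩ (hnb ν).2.1 ?_ ?_ ?_
    · show (b.src.unshift ν).shift ν ∉ Ω 1
      rw [shift_unshift_site]; exact hx'
    · show (b.src.unshift ν).shift b.dir ∉ Ω 1
      rw [unshift_shift_comm_site]; exact (hnb ν).2.2.2
    · rcases hbΩ₀ with h0 | h0
      · exact Or.inr (Or.inl (by show (b.src.unshift ν).shift ν ∈ Ω₀; rw [shift_unshift_site]; exact h0))
      · refine Or.inr (Or.inr (Or.inr ?_))
        show ((b.src.unshift ν).shift ν).shift b.dir ∈ Ω₀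
        rw [shift_unshift_site]; exact h0
  · -- `p_{νμ}(x)`: corners `x`, `x + e_ν`, `x + e_μ`
    refine key ⟨b.src, ν, b.dir, h⟩ hx' (hnb ν).1 hxμ' ?_
    rcases hbΩ₀ with h0 | h0
    · exact Or.inl h0
    · exact Or.inr (Or.inr (Or.inl h0))
  · -- `p_{μν}(x − e_ν)`: corners `x − e_ν`, `(x + e_μ) − e_ν`, `x`, `x + e_μ`
    refine key ⟨b.src.unshift ν, b.dir, ν, h⟩ (hnb ν).2.1 ?_ ?_ ?_
    · show (b.src.unshift ν).shift b.dir ∉ Ω 1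
      rw [unshift_shift_comm_site]; exact (hnb ν).2.2.2
    · show (b.src.unshift ν).shift ν ∉ Ω 1
      rw [shift_unshift_site]; exact hx'
    · rcases hbΩ₀ with h0 | h0
      · refine Or.inr (Or.inr (Or.inl ?_))
        show (b.src.unshift ν).shift ν ∈ Ω₀
        rw [shift_unshift_site]; exact h0
      · refine Or.inr (Or.inr (Or.inr ?_))
        show ((b.src.unshift ν).shift b.dir).shift ν ∈ Ω₀
        rw [unshift_shift_comm_site, shift_unshift_site]; exact h0
  · -- `p_{μν}(x)`: corners `x`, `x + e_μ`, `x + e_ν`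
    refine key ⟨b.src, b.dir, ν, h⟩ hx' hxμ' (hnb ν).1 ?_
    rcases hbΩ₀ with h0 | h0
    · exact Or.inl h0
    · exact Or.inr (Or.inl h0)
/-! ## §1  ★★ The Core ⇒ Top link POINTWISE (guard-agnostic) -/

section Pointwise

variable {F : T4Family} {N : ℕ} [NeZero N]

/-- ★★ **[15] SECT. F's ONE-STEP IMPROVEMENT FROM ITS CORE FORM, AT ONE BINDER INSTANCE** (p586684 §2 with the ∀-prefix stripped): for a separated index `s` with `0 < M₁`, `1 ≤ k`,
ANY top set `Sup₀ ⊇ Ω₁`, `2L² ≤ B₃`, thresholds with `0 < δ₀ ≤ 2δ₁`, a datum `W` carrying (7) on the top range and a configuration `U` on its fibre, the CORE conclusion pair (the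
one-step bound at the plaquettes of the top class that are NOT printed and at the bonds that are NOT far from `Ω₁`) yields the FULL conclusion pair (EVERY plaquette ∕ bond of the top
class).  Printed level-`0` plaquettes are pinned data `< δ₀ ≤ B₃δ₀`; the level-`1` printed (corner) plaquettes `< δ₀ ≤ 2δ₁ ≤ B₃δ₁·L⁻²` (THIS spends the floor `2L² ≤ B₃`); no printed
plaquette meets `Ω_n`, `n ≥ 2` (separation); a far bond reads `2d = 8` pinned plaquettes `≤ 8δ₀ < B₃δ₀`, and no bond meeting `Ω_n ⊆ Ω₁`, `n ≥ 1`, is far.  Guard-agnostic: every ∀-edition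
(floor-free p586684, floor `c ≤ ν.M₁` §2, dag-n07-e module 47's generic guard) is a wrapper of this.
[cite: Balaban1985Variational, Sect. F p.304, (2),(3),(7),(8) p.278, Prop. 8 p.304; Balaban1985RegularSpaces, (1.2) p.76, (1.3)–(1.9) p.77; Balaban1988Convergent, (2.10)–(2.12) p.256] -/
theorem halvingStep_top_of_core_at {K : ℕ} {ν : Stage7Numerics} {M : ℕ} {g : ℕ → ℝ} {k : ℕ} {s : SeqOfRecord F ν M g K k}
    (hsep : Sect2.SeqSeparated ν.M₁ s) (hM₁ : 0 < ν.M₁) (hk : 1 ≤ k) {Sup₀ : Set (Site (F.P K) 0)} (hΩ1Sup : s.Ω 1 ⊆ Sup₀)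
    {B₃ : ℝ} (hB₃ : 2 * (F.L : ℝ) ^ 2 ≤ B₃) {ε δ : ℕ → ℝ} (hδ0 : 0 < δ 0) (hcomp0 : δ 0 ≤ 2 * δ 1)
    {W : MSField (F.P K) (SU N)} (h7 : Sect2.DataSmall7PTop (avOfRecord F N K) s.Ω Sup₀ k δ W) {U : GaugeField (F.P K) 0 (SU N)}
    (hfib : AgreeOn (genSet s.Ω k) (avgFamily (avOfRecord F N K) U) W)
    (hP : ∀ n, n ≤ k → ∀ p ∈ Sect2.omegaPlaqsTop s.Ω Sup₀ n, p ∉ Sect2.printedPlaqs s.Ω k 0 →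
      dist1 (GaugeField.plaqHol U p) < max (B₃ * δ n) (ε n / 2) * (F.P K).eta n ^ 2)
    (hD : ∀ n, n ≤ k → ∀ b ∈ Sect2.omegaBondsTop s.Ω Sup₀ n, b ∉ Sect2.bondsDeep (s.Ω 1)ᶜ →
      ‖Sect2.coDivSum U b.src b.dir‖ < max (B₃ * δ n) (ε n / 2) * (F.P K).eta n ^ 3) :
    (∀ n, n ≤ k → PlaqSmallOn (Sect2.omegaPlaqsTop s.Ω Sup₀ n) (max (B₃ * δ n) (ε n / 2) * (F.P K).eta n ^ 2) U) ∧
      ∀ n, n ≤ k → Sect2.CoDivSmallOn (Sect2.omegaBondsTop s.Ω Sup₀ n) (max (B₃ * δ n) (ε n / 2) * (F.P K).eta n ^ 3) U := by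
  have hk0 : 0 < k := hk
  have hL11 : (11 : ℝ) < F.L := by exact_mod_cast F.hL11
  have hB₃8 : (8 : ℝ) < B₃ := by nlinarith
  have hB₃1 : (1 : ℝ) ≤ B₃ := by linarith
  -- the plaquette set of the top class at level `n` lies in `plaqsOf Sup₀`
  have hplaqs : ∀ n, n ≤ k → Sect2.omegaPlaqsTop s.Ω Sup₀ n ⊆ B8Eq17ClassAkV1.plaqsOf Sup₀ := by
    intro n hn p hp
    rcases Nat.eq_zero_or_pos n with rfl | hn0
    · rwa [Sect2.omegaPlaqsTop_zero] at hp
    · rw [Sect2.omegaPlaqsTop_of_ne_zero _ _ hn0.ne', omegaPlaqs_of_ne_zero _ hn0.ne'] at hp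
      exact B8Eq17ClassAkV1.plaqsOf_mono ((s.chain.Ω_antitone le_rfl hn0 hn).trans hΩ1Sup) hp
  refine ⟨fun n hn p hp => ?_, fun n hn b hb => ?_⟩
  · -- (1.7) member
    by_cases hpr : p ∈ Sect2.printedPlaqs s.Ω k 0
    swap
    · exact hP n hn p hp hpr
    have hdata : dist1 (GaugeField.plaqHol U p) < δ 0 := dist1_plaqHol_lt_of_mem_printedPlaqs hk0 h7 hfib hpr (hplaqs n hn hp)
    rcases Nat.lt_or_ge n 2 with hn2 | hn2
    · interval_cases n
      · -- level 0: `δ₀ ≤ B₃δ₀`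
        have hη0 : (F.P K).eta 0 = 1 := by simp [Params.eta]
        rw [hη0, one_pow, mul_one]
        calc dist1 (GaugeField.plaqHol U p) < δ 0 := hdata
          _ ≤ B₃ * δ 0 := le_mul_of_one_le_left hδ0.le hB₃1
          _ ≤ max (B₃ * δ 0) (ε 0 / 2) := le_max_left _ _
      · -- level 1: `δ₀ ≤ 2δ₁ ≤ B₃δ₁·L⁻²` (the floor `2L² ≤ B₃`)
        have hη1 : (F.P K).eta 1 = (F.L : ℝ)⁻¹ := by simp [Params.eta]
        have hLpos : (0 : ℝ) < F.L := by linarith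
        rw [hη1]
        have hkey : 2 * δ 1 ≤ max (B₃ * δ 1) (ε 1 / 2) * (F.L : ℝ)⁻¹ ^ 2 := by
          have hδ1 : 0 ≤ δ 1 := by linarith
          calc 2 * δ 1 = (2 * (F.L : ℝ) ^ 2 * δ 1) * (F.L : ℝ)⁻¹ ^ 2 := by field_simp
            _ ≤ (B₃ * δ 1) * (F.L : ℝ)⁻¹ ^ 2 := by gcongr
            _ ≤ max (B₃ * δ 1) (ε 1 / 2) * (F.L : ℝ)⁻¹ ^ 2 := by gcongr; exact le_max_left _ _
        linarith
    · -- levels `n ≥ 2`: no printed plaquette meets `Ω_n`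
      exfalso
      rw [Sect2.omegaPlaqsTop_of_ne_zero _ _ (by omega), omegaPlaqs_of_ne_zero _ (by omega)] at hp
      exact not_mem_printedPlaqs_zero_of_mem_plaqsOf hsep hM₁ hn2 hn hp hpr
  · -- (1.9) member
    by_cases hbd : b ∈ Sect2.bondsDeep (s.Ω 1)ᶜ
    swap
    · exact hD n hn b hb hbd
    rcases Nat.eq_zero_or_pos n with rfl | hn0
    · -- level 0: a far bond of the support reads pinned data on its whole stencil
      rw [Sect2.omegaBondsTop_zero] at hb
      have hη0 : (F.P K).eta 0 = 1 := by simp [Params.eta]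
      rw [hη0, one_pow, mul_one]
      have hle := norm_coDivSum_le_of_mem_bondsDeep_compl hk0 hδ0.le h7 hfib hb hbd
      rw [T4Family.P_d] at hle
      push_cast at hle
      calc ‖Sect2.coDivSum U b.src b.dir‖ ≤ 4 * (2 * δ 0) := hle
        _ < B₃ * δ 0 := by nlinarith
        _ ≤ max (B₃ * δ 0) (ε 0 / 2) := le_max_left _ _
    · -- levels `n ≥ 1`: a bond meeting `Ω_n ⊆ Ω₁` is not far
      exfalso
      rw [Sect2.omegaBondsTop_of_ne_zero _ _ hn0.ne'] at hb
      have hb' : b ∈ bondsOf (s.Ω n) := by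
        unfold Sect2.omegaBonds at hb; rwa [if_neg hn0.ne'] at hb
      have hΩn1 : s.Ω n ⊆ s.Ω 1 := s.chain.Ω_antitone le_rfl hn0 hn
      rcases hb' with h1 | h1
      · exact hbd.1 (hΩn1 h1)
      · exact hbd.2.1 (hΩn1 h1)

end Pointwise

/-! ## §2  ★★ `HalvingStepTopR c` FROM `HalvingStepTopCoreR c` (the floor `c ≤ ν.M₁` threaded), and Prop. 8's top step with the floor -/

section MainR

variable {F : T4Family} {N : ℕ} [NeZero N]

/-- ★★ **[15] SECT. F's ONE-STEP IMPROVEMENT WITH THE FLOOR `c ≤ ν.M₁`, FROM ITS CORE FORM** (dag-n07-e module 46's tokens; p586684 §2 with `hc : c ≤ ν.M₁` threaded — the ONE missing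
link of the floor-carrying chain (R-a)): if the top domain contains `Ω₁` whenever `0 < M₁` (the support of record does, `suppDomOfRecord_one_subset`) and `2L² ≤ B₃`, then
`HalvingStepTopCoreR F N Sup c B₃ a₀ a₁ ⇒ HalvingStepTopR F N Sup c B₃ a₀ a₁`.  Three lines over §1.
[cite: Balaban1985Variational, Sect. F p.304, (7),(8) p.278, Prop. 8 p.304; Balaban1985RegularSpaces, (1.3)–(1.9) p.77] -/
theorem halvingStepTopR_of_coreR {Sup : (ν : Stage7Numerics) → (K : ℕ) → (ℕ → Set (Site (F.P K) 0)) → Set (Site (F.P K) 0)} {c : ℕ} {B₃ a₀ a₁ : ℝ}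
    (hSup : ∀ (ν : Stage7Numerics) (K : ℕ) (Ω : ℕ → Set (Site (F.P K) 0)), 0 < ν.M₁ → Ω 1 ⊆ Sup ν K Ω)
    (hB₃ : 2 * (F.L : ℝ) ^ 2 ≤ B₃) (h : HalvingStepTopCoreR F N Sup c B₃ a₀ a₁) : HalvingStepTopR F N Sup c B₃ a₀ a₁ := by
  intro ν M g K k s hsep hM₁ hc hk ε δ hδ hcomp hcomp' hε hεcomp hεcomp' W h7 U h17 h19 hfib hcrit
  obtain ⟨hP, hD⟩ := h ν M g K k s hsep hM₁ hc hk ε δ hδ hcomp hcomp' hε hεcomp hεcomp' W h7 U h17 h19 hfib hcrit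
  exact halvingStep_top_of_core_at hsep hM₁ hk (hSup ν K s.Ω hM₁) hB₃ (hδ 0 (Nat.zero_le _)).1 (hcomp 0 hk) h7 hfib hP hD

/-- ★ **EQUIVALENCE WITH THE FLOOR** (for `2L² ≤ B₃` and a top domain containing `Ω₁`): `HalvingStepTopR c ⟺ HalvingStepTopCoreR c` (module 46's restriction
`halvingStepTopCoreR_of_halvingStepTopR` is the converse). [cite: Balaban1985Variational, Sect. F p.304, Prop. 8 p.304 (bookkeeping)] -/
theorem halvingStepTopR_iff_coreR {Sup : (ν : Stage7Numerics) → (K : ℕ) → (ℕ → Set (Site (F.P K) 0)) → Set (Site (F.P K) 0)} {c : ℕ} {B₃ a₀ a₁ : ℝ}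
    (hSup : ∀ (ν : Stage7Numerics) (K : ℕ) (Ω : ℕ → Set (Site (F.P K) 0)), 0 < ν.M₁ → Ω 1 ⊆ Sup ν K Ω)
    (hB₃ : 2 * (F.L : ℝ) ^ 2 ≤ B₃) : HalvingStepTopR F N Sup c B₃ a₀ a₁ ↔ HalvingStepTopCoreR F N Sup c B₃ a₀ a₁ :=
  ⟨halvingStepTopCoreR_of_halvingStepTopR, halvingStepTopR_of_coreR hSup hB₃⟩

/-- ★★ **PROPOSITION 8's TOP STEP WITH THE FLOOR FROM THE CORE ONE-STEP FACT WITH THE FLOOR, ANY TOP DOMAIN CONTAINING `Ω₁`** (module 46 §4 `prop8RegSepTopStepR_of_halvingStepTopR`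
after `halvingStepTopR_of_coreR`; `0 < B₃` from `2L² ≤ B₃`). [cite: Balaban1985Variational, Prop. 8 p.304, Sect. F pp.300–304] -/
theorem prop8RegSepTopStepR_of_coreR_of_sup {Sup : (ν : Stage7Numerics) → (K : ℕ) → (ℕ → Set (Site (F.P K) 0)) → Set (Site (F.P K) 0)} {c : ℕ} {B₃ a₀ a₁ : ℝ}
    (hSup : ∀ (ν : Stage7Numerics) (K : ℕ) (Ω : ℕ → Set (Site (F.P K) 0)), 0 < ν.M₁ → Ω 1 ⊆ Sup ν K Ω)
    (hB₃ : 2 * (F.L : ℝ) ^ 2 ≤ B₃) (h : HalvingStepTopCoreR F N Sup c B₃ a₀ a₁) : Prop8RegSepTopStepR F N Sup c B₃ a₀ a₁ := by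
  have hL11 : (11 : ℝ) < F.L := by exact_mod_cast F.hL11
  have hB₃0 : 0 < B₃ := by nlinarith
  exact prop8RegSepTopStepR_of_halvingStepTopR hB₃0 (halvingStepTopR_of_coreR hSup hB₃ h)

/-- ★★ **PROPOSITION 8's TOP STEP WITH THE FLOOR FROM THE CORE ONE-STEP FACT WITH THE FLOOR, AT THE SUPPORT OF RECORD** (`Ω₁ ⊆ suppDomOfRecord …` = p586684's
`suppDomOfRecord_one_subset`; the R-edition of p586684's `prop8RegSepTopStep_of_core`). [cite: Balaban1985Variational, Prop. 8 p.304, Sect. F pp.300–304; Balaban1988Convergent, p.255] -/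
theorem prop8RegSepTopStepR_of_coreR {c : ℕ} {B₃ a₀ a₁ : ℝ} (hB₃ : 2 * (F.L : ℝ) ^ 2 ≤ B₃)
    (h : HalvingStepTopCoreR F N (fun ν K Ω => suppDomOfRecord F ν K Ω) c B₃ a₀ a₁) :
    Prop8RegSepTopStepR F N (fun ν K Ω => suppDomOfRecord F ν K Ω) c B₃ a₀ a₁ :=
  prop8RegSepTopStepR_of_coreR_of_sup (fun ν K Ω hM₁ => (subset_hullD_self (F.P K) ν.M₁ hM₁ 1 (Ω 1))) hB₃ h

end MainR

/-! ## §3  ★★ Under ANY prefix guard `Adm : StepGuard F` (dag-n07-e module 47): the `hlink` hypothesis of `prop8RegSepTopStepG_of_coreG_of_link` DISCHARGED -/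

section MainG

variable {F : T4Family} {N : ℕ} [NeZero N]

/-- ★★ **[15] SECT. F's ONE-STEP IMPROVEMENT UNDER ANY PREFIX GUARD, FROM ITS CORE FORM** (dag-n07-e module 47's tokens `HalvingStepTopCoreG ∕ HalvingStepTopG F N Sup Adm B₃ a₀ a₁`,
`Adm : StepGuard F` = a predicate on `(ν, M, g, K, k, s)` inserted after `0 < ν.M₁` — the one slot for the `M₁`-floor AND the `k`-face guard): if the top domain contains `Ω₁` whenever
`0 < M₁` and `2L² ≤ B₃`, then `HalvingStepTopCoreG Adm ⇒ HalvingStepTopG Adm` for EVERY guard — the guard is threaded, never inspected.  Three lines over §1.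
[cite: Balaban1985Variational, Sect. F p.304, (7),(8) p.278, Prop. 8 p.304; Balaban1985RegularSpaces, (1.3)–(1.9) p.77; Balaban1987RG1, (0.1) p.251] -/
theorem halvingStepTopG_of_coreG {Sup : (ν : Stage7Numerics) → (K : ℕ) → (ℕ → Set (Site (F.P K) 0)) → Set (Site (F.P K) 0)} {Adm : StepGuard F} {B₃ a₀ a₁ : ℝ}
    (hSup : ∀ (ν : Stage7Numerics) (K : ℕ) (Ω : ℕ → Set (Site (F.P K) 0)), 0 < ν.M₁ → Ω 1 ⊆ Sup ν K Ω)
    (hB₃ : 2 * (F.L : ℝ) ^ 2 ≤ B₃) (h : HalvingStepTopCoreG F N Sup Adm B₃ a₀ a₁) : HalvingStepTopG F N Sup Adm B₃ a₀ a₁ := by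
  intro ν M g K k s hsep hM₁ hadm hk ε δ hδ hcomp hcomp' hε hεcomp hεcomp' W h7 U h17 h19 hfib hcrit
  obtain ⟨hP, hD⟩ := h ν M g K k s hsep hM₁ hadm hk ε δ hδ hcomp hcomp' hε hεcomp hεcomp' W h7 U h17 h19 hfib hcrit
  exact halvingStep_top_of_core_at hsep hM₁ hk (hSup ν K s.Ω hM₁) hB₃ (hδ 0 (Nat.zero_le _)).1 (hcomp 0 hk) h7 hfib hP hD

/-- ★ **EQUIVALENCE UNDER ANY GUARD** (for `2L² ≤ B₃` and a top domain containing `Ω₁`): `HalvingStepTopG Adm ⟺ HalvingStepTopCoreG Adm` (module 47's restriction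
`halvingStepTopCoreG_of_halvingStepTopG` is the converse). [cite: Balaban1985Variational, Sect. F p.304, Prop. 8 p.304 (bookkeeping)] -/
theorem halvingStepTopG_iff_coreG {Sup : (ν : Stage7Numerics) → (K : ℕ) → (ℕ → Set (Site (F.P K) 0)) → Set (Site (F.P K) 0)} {Adm : StepGuard F} {B₃ a₀ a₁ : ℝ}
    (hSup : ∀ (ν : Stage7Numerics) (K : ℕ) (Ω : ℕ → Set (Site (F.P K) 0)), 0 < ν.M₁ → Ω 1 ⊆ Sup ν K Ω)
    (hB₃ : 2 * (F.L : ℝ) ^ 2 ≤ B₃) : HalvingStepTopG F N Sup Adm B₃ a₀ a₁ ↔ HalvingStepTopCoreG F N Sup Adm B₃ a₀ a₁ :=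
  ⟨halvingStepTopCoreG_of_halvingStepTopG, halvingStepTopG_of_coreG hSup hB₃⟩

/-- ★★ **PROPOSITION 8's TOP STEP UNDER ANY GUARD FROM THE GUARDED CORE ONE-STEP FACT, ANY TOP DOMAIN CONTAINING `Ω₁`**: module 47's one-line chain
`prop8RegSepTopStepG_of_coreG_of_link` with its `hlink` hypothesis DISCHARGED by `halvingStepTopG_of_coreG` (`0 < B₃` from `2L² ≤ B₃`).
[cite: Balaban1985Variational, Prop. 8 p.304, Sect. F pp.300–304; Balaban1987RG1, (0.1) p.251] -/
theorem prop8RegSepTopStepG_of_coreG_of_sup {Sup : (ν : Stage7Numerics) → (K : ℕ) → (ℕ → Set (Site (F.P K) 0)) → Set (Site (F.P K) 0)} {Adm : StepGuard F} {B₃ a₀ a₁ : ℝ}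
    (hSup : ∀ (ν : Stage7Numerics) (K : ℕ) (Ω : ℕ → Set (Site (F.P K) 0)), 0 < ν.M₁ → Ω 1 ⊆ Sup ν K Ω)
    (hB₃ : 2 * (F.L : ℝ) ^ 2 ≤ B₃) (h : HalvingStepTopCoreG F N Sup Adm B₃ a₀ a₁) : Prop8RegSepTopStepG F N Sup Adm B₃ a₀ a₁ := by
  have hL11 : (11 : ℝ) < F.L := by exact_mod_cast F.hL11
  have hB₃0 : 0 < B₃ := by nlinarith
  exact prop8RegSepTopStepG_of_coreG_of_link hB₃0 (halvingStepTopG_of_coreG hSup hB₃) h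

/-- ★★ **PROPOSITION 8's TOP STEP UNDER ANY GUARD FROM THE GUARDED CORE ONE-STEP FACT, AT THE SUPPORT OF RECORD** (`Ω₁ ⊆ suppDomOfRecord …` = p586684's
`suppDomOfRecord_one_subset`). [cite: Balaban1985Variational, Prop. 8 p.304, Sect. F pp.300–304; Balaban1988Convergent, p.255; Balaban1987RG1, (0.1) p.251] -/
theorem prop8RegSepTopStepG_of_coreG {Adm : StepGuard F} {B₃ a₀ a₁ : ℝ} (hB₃ : 2 * (F.L : ℝ) ^ 2 ≤ B₃)
    (h : HalvingStepTopCoreG F N (fun ν K Ω => suppDomOfRecord F ν K Ω) Adm B₃ a₀ a₁) :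
    Prop8RegSepTopStepG F N (fun ν K Ω => suppDomOfRecord F ν K Ω) Adm B₃ a₀ a₁ :=
  prop8RegSepTopStepG_of_coreG_of_sup (fun ν K Ω hM₁ => (subset_hullD_self (F.P K) ν.M₁ hM₁ 1 (Ω 1))) hB₃ h

end MainG

/-! ## §4  The floor-carrying chain END TO END from the S6 head's per-datum R-tokens (p621398 ∘ §2), at the support of record -/

section ChainR

variable {F : T4Family} {N : ℕ} [NeZero N]

/-- ★★ **THE (165)-LETTER TOKEN WITH THE FLOOR CLOSES PROP. 8's TOP STEP WITH THE FLOOR** at the support of record: `LocalLetters165TopStepCoreR c ⇒ Prop8RegSepTopStepR c` under p621398 §1's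
smallness letters `128C ≤ B₃`, `512θ ≤ 1`, `0 ≤ Q`, `512Q·a₀ ≤ 1`, `2a₀ ≤ 1` and the registered floor `2L² ≤ B₃`. [cite: Balaban1985Variational, (165)–(168) p.304, Prop. 8 p.304; Balaban1985RegularSpaces, (1.7)–(1.9) p.77] -/
theorem prop8RegSepTopStepR_of_localLetters165CoreR {c : ℕ} {B₃ C θ Q a₀ a₁ : ℝ}
    (h : LocalLetters165TopStepCoreR F N (fun ν K Ω => suppDomOfRecord F ν K Ω) c B₃ C θ Q a₀ a₁) (hB₃ : 2 * (F.L : ℝ) ^ 2 ≤ B₃) (hC : 128 * C ≤ B₃)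
    (hθ' : 512 * θ ≤ 1) (hQ : 0 ≤ Q) (ha : 512 * Q * a₀ ≤ 1) (ha₀ : 2 * a₀ ≤ 1) :
    Prop8RegSepTopStepR F N (fun ν K Ω => suppDomOfRecord F ν K Ω) c B₃ a₀ a₁ :=
  have hB₃0 : 0 ≤ B₃ := (mul_nonneg zero_le_two (sq_nonneg _)).trans hB₃
  prop8RegSepTopStepR_of_coreR hB₃ (halvingStepTopCoreR_of_localLetters165CoreR h hB₃0 hC hθ' hQ ha ha₀)

/-- ★★ **THE SPLIT-LETTER TOKEN WITH THE FLOOR CLOSES PROP. 8's TOP STEP WITH THE FLOOR, ROAD R0′** at the support of record: `LocalLettersSplitTopStepCoreR c ⇒ Prop8RegSepTopStepR c` under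
p621398 §2's smallness letters and `2L² ≤ B₃`. [cite: Balaban1985Variational, (165)–(168) p.304, Prop. 8 p.304; Balaban1985RegularSpaces, (1.7)–(1.9) p.77, (1.54) p.85] -/
theorem prop8RegSepTopStepR_of_localLettersSplitCoreR {c : ℕ} {B₃ C θ Q κ a₀ a₁ : ℝ}
    (h : LocalLettersSplitTopStepCoreR F N (fun ν K Ω => suppDomOfRecord F ν K Ω) c B₃ C θ Q κ a₀ a₁) (hB₃ : 2 * (F.L : ℝ) ^ 2 ≤ B₃) (hC : 4 * C ≤ B₃)
    (hθ : 16 * θ ≤ 1) (hQ : 0 ≤ Q) (hκ : 0 ≤ κ) (ha : (16 * Q + 1024 * κ ^ 2) * a₀ ≤ 1) (hκa : 32 * κ * a₀ ≤ 1) :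
    Prop8RegSepTopStepR F N (fun ν K Ω => suppDomOfRecord F ν K Ω) c B₃ a₀ a₁ :=
  have hB₃0 : 0 ≤ B₃ := (mul_nonneg zero_le_two (sq_nonneg _)).trans hB₃
  prop8RegSepTopStepR_of_coreR hB₃ (halvingStepTopCoreR_of_localLettersSplitCoreR h hB₃0 hC hθ hQ hκ ha hκa)

/-- ★★★ **END TO END, (165) ROAD: THE HEAD's PER-DATUM (165)-GAUGE TOKEN WITH THE FLOOR CLOSES PROP. 8's TOP STEP WITH THE FLOOR** at the support of record (`Mc ≥ 1`, `ρ ≥ L`):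
`DatumGauge165TopStepCoreR Mc ρ c ⇒ LocalLetters165TopStepCoreR c ⇒ HalvingStepTopCoreR c ⇒ HalvingStepTopR c ⇒ Prop8RegSepTopStepR c`.
[cite: Balaban1985Variational, p.302, (165)–(168) p.304, Prop. 8 p.304, Sect. F pp.300–304; Balaban1985RegularSpaces, (1.7)–(1.9) p.77] -/
theorem prop8RegSepTopStepR_of_datumGauge165CoreR {Mc ρ c : ℕ} (hMc : 1 ≤ Mc) (hρ : F.L ≤ ρ) {B₃ C θ Q a₀ a₁ : ℝ}
    (h : DatumGauge165TopStepCoreR F N (fun ν K Ω => suppDomOfRecord F ν K Ω) Mc ρ c B₃ C θ Q a₀ a₁) (hB₃ : 2 * (F.L : ℝ) ^ 2 ≤ B₃) (hC : 128 * C ≤ B₃)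
    (hθ' : 512 * θ ≤ 1) (hQ : 0 ≤ Q) (ha : 512 * Q * a₀ ≤ 1) (ha₀ : 2 * a₀ ≤ 1) :
    Prop8RegSepTopStepR F N (fun ν K Ω => suppDomOfRecord F ν K Ω) c B₃ a₀ a₁ :=
  have hB₃0 : 0 ≤ B₃ := (mul_nonneg zero_le_two (sq_nonneg _)).trans hB₃
  prop8RegSepTopStepR_of_coreR hB₃ (halvingStepTopCoreR_of_datumGauge165CoreR hMc hρ h hB₃0 hC hθ' hQ ha ha₀)

/-- ★★★ **END TO END, ROAD R0′: THE HEAD's PER-DATUM SPLIT-GAUGE TOKEN WITH THE FLOOR CLOSES PROP. 8's TOP STEP WITH THE FLOOR** at the support of record (`Mc ≥ 1`, `ρ ≥ L`):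
`DatumGaugeSplitTopStepCoreR Mc ρ c ⇒ LocalLettersSplitTopStepCoreR c ⇒ HalvingStepTopCoreR c ⇒ HalvingStepTopR c ⇒ Prop8RegSepTopStepR c` — with dag-n07-e module 46 this is the
floor-carrying chain of LOCATED-STUB1-FLOOR's repair (R-a) by name; only the V20 skeleton text (R-b) remains the plan's.
[cite: Balaban1985Variational, p.302, (165)–(168) p.304, Prop. 8 p.304, Sect. F pp.300–304; Balaban1985RegularSpaces, (1.7)–(1.9) p.77, (1.54) p.85] -/
theorem prop8RegSepTopStepR_of_datumGaugeSplitCoreR {Mc ρ c : ℕ} (hMc : 1 ≤ Mc) (hρ : F.L ≤ ρ) {B₃ C θ Q κ a₀ a₁ : ℝ}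
    (h : DatumGaugeSplitTopStepCoreR F N (fun ν K Ω => suppDomOfRecord F ν K Ω) Mc ρ c B₃ C θ Q κ a₀ a₁) (hB₃ : 2 * (F.L : ℝ) ^ 2 ≤ B₃) (hC : 4 * C ≤ B₃)
    (hθ : 16 * θ ≤ 1) (hQ : 0 ≤ Q) (hκ : 0 ≤ κ) (ha : (16 * Q + 1024 * κ ^ 2) * a₀ ≤ 1) (hκa : 32 * κ * a₀ ≤ 1) :
    Prop8RegSepTopStepR F N (fun ν K Ω => suppDomOfRecord F ν K Ω) c B₃ a₀ a₁ :=
  have hB₃0 : 0 ≤ B₃ := (mul_nonneg zero_le_two (sq_nonneg _)).trans hB₃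
  prop8RegSepTopStepR_of_coreR hB₃ (halvingStepTopCoreR_of_datumGaugeSplitCoreR hMc hρ h hB₃0 hC hθ hQ hκ ha hκa)

end ChainR

/-! ## §5  The (R-b) candidate shape (dag-n07-e's proposed V20 text; NOT registered — the plan's word) -/

section CandidateRb

/-- ★ **THE (R-b) CANDIDATE SHAPE FROM THE CORE ONE-PASS SENTENCE WITH A FLOOR** (`N = 2`, the support of record): a seat landing
`∃ c B₃ a₀ a₁, 2L² ≤ B₃ ∧ 0 < a₀ ∧ 0 < a₁ ∧ HalvingStepTopCoreR F 2 suppDom c B₃ a₀ a₁` gets dag-n07-e's proposed V20 body `∃ c B₃ a₀ a₁, 2L² ≤ B₃ ∧ 0 < a₀ ∧ 0 < a₁ ∧ Prop8RegSepTopStepR F 2 suppDom c B₃ a₀ a₁`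
in one line (the R-edition of p586684's `prop8StepCoP_of_core`).  CONDITIONAL; the V20 text is NOT registered here. [cite: Balaban1985Variational, Prop. 8 p.304, Sect. F pp.300–304 (bookkeeping)] -/
theorem prop8StepCoPR_of_coreR (F : T4Family)
    (h : ∃ (c : ℕ) (B₃ a₀ a₁ : ℝ), 2 * (F.L : ℝ) ^ 2 ≤ B₃ ∧ 0 < a₀ ∧ 0 < a₁ ∧
      HalvingStepTopCoreR F 2 (fun ν K Ω => suppDomOfRecord F ν K Ω) c B₃ a₀ a₁) :
    ∃ (c : ℕ) (B₃ a₀ a₁ : ℝ), 2 * (F.L : ℝ) ^ 2 ≤ B₃ ∧ 0 < a₀ ∧ 0 < a₁ ∧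
      Prop8RegSepTopStepR F 2 (fun ν K Ω => suppDomOfRecord F ν K Ω) c B₃ a₀ a₁ := by
  obtain ⟨c, B₃, a₀, a₁, hB₃, ha₀, ha₁, h⟩ := h
  exact ⟨c, B₃, a₀, a₁, hB₃, ha₀, ha₁, prop8RegSepTopStepR_of_coreR hB₃ h⟩

/-- ★ **THE (R-b) CANDIDATE SHAPE FROM THE HEAD's PER-DATUM SPLIT-GAUGE TOKEN WITH A FLOOR** (`N = 2`, road R0′): the STEP-7 ∃-introduction's output sentence, quantified as
`∃ Mc ρ c B₃ C θ Q κ a₀ a₁` with the numeric side conditions of p621398 §2 and the registered floor, yields dag-n07-e's proposed V20 body.  CONDITIONAL; NOT registered.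
[cite: Balaban1985Variational, p.302, (165)–(168) p.304, Prop. 8 p.304 (bookkeeping); Balaban1985RegularSpaces, (1.54) p.85] -/
theorem prop8StepCoPR_of_datumGaugeSplitCoreR (F : T4Family)
    (h : ∃ (Mc ρ c : ℕ) (B₃ C θ Q κ a₀ a₁ : ℝ), 1 ≤ Mc ∧ F.L ≤ ρ ∧ 2 * (F.L : ℝ) ^ 2 ≤ B₃ ∧ 4 * C ≤ B₃ ∧ 16 * θ ≤ 1 ∧ 0 ≤ Q ∧ 0 ≤ κ ∧
      (16 * Q + 1024 * κ ^ 2) * a₀ ≤ 1 ∧ 32 * κ * a₀ ≤ 1 ∧ 0 < a₀ ∧ 0 < a₁ ∧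
      DatumGaugeSplitTopStepCoreR F 2 (fun ν K Ω => suppDomOfRecord F ν K Ω) Mc ρ c B₃ C θ Q κ a₀ a₁) :
    ∃ (c : ℕ) (B₃ a₀ a₁ : ℝ), 2 * (F.L : ℝ) ^ 2 ≤ B₃ ∧ 0 < a₀ ∧ 0 < a₁ ∧
      Prop8RegSepTopStepR F 2 (fun ν K Ω => suppDomOfRecord F ν K Ω) c B₃ a₀ a₁ := by
  obtain ⟨Mc, ρ, c, B₃, C, θ, Q, κ, a₀, a₁, hMc, hρ, hB₃, hC, hθ, hQ, hκ, ha, hκa, ha₀, ha₁, h⟩ := h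
  exact ⟨c, B₃, a₀, a₁, hB₃, ha₀, ha₁, prop8RegSepTopStepR_of_datumGaugeSplitCoreR hMc hρ h hB₃ hC hθ hQ hκ ha hκa⟩

end CandidateRb

end Summit.QuantumFields.YangMills.Theorems.K0HalvingStepOfCoreFloor

end
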